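import Mathlib
import Summits.Ventures.HodgeRepro2.T5DVRQuotientModel

/-!
# T5ShiftCharacter — Kudla's `ψ_n` for an additive character of ARBITRARY conductor: `π x ↦ Ψ(x ϖ^{-k})` on
`𝒪 ⧸ (ϖ^{m+1})`, well defined iff `Ψ` is trivial on `ϖ^{m+1-k}𝒪`, primitive iff `Ψ` is non-trivial on `ϖ^{m-k}𝒪`

Kernel support for Tier 5, sub-step N5 / §G, reading residual [R-4] (route/T5-CHECK-G-p7.md §4, §16.2 row P1.10).
`T5DVRQuotientModel.shiftChar` is the case `k = m + 1` (`Ψ` trivial on `𝒪`, Kudla's `ν = 0`). Kudla's Gauss sum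
`𝔤(ω, ψ) = q^{(ν+c)/2} ∫_{𝒪^×} ω^{-1}(y) ψ(ϖ^{-ν-c} y) dy` uses the shift by `ϖ^{-(ν+c)}` where `ψ` has conductor
`𝔭^{-ν}` (trivial on `𝔭^{-ν}`, non-trivial on `𝔭^{-ν-1}`); for the finite sum on `𝒪/𝔭^c` the shifted character
`x ↦ ψ(ϖ^{-(ν+c)} x)` must be trivial on `𝔭^c` — i.e. `ψ` trivial on `ϖ^{-ν}𝒪` — and is primitive exactly when `ψ`
is non-trivial on `ϖ^{-ν-1}𝒪`. With `c = m + 1` and `k = ν + c ∈ ℤ` (so that `c − k = −ν`, `m − k = −ν − 1`):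

* `shiftCharAuxZ Ψ ϖ k : AddChar 𝒪 M`, `x ↦ Ψ(x · ϖ^{-k})` (`zpow` in the fraction field `K`);
* `shiftCharAuxZ_eq_one_of_mem`: it is trivial on `(ϖ^{m+1})` when `Ψ` is trivial on `ϖ^{m+1-k}𝒪`;
* `shiftCharZ m hϖ Ψ k hΨ : AddChar (𝒪 ⧸ (ϖ^{m+1})) M` — the descended character, `shiftCharZ_mk`;
* **`isPrimitive_shiftCharZ_iff`**: it is primitive iff `Ψ` is non-trivial on `ϖ^{m-k}𝒪`;
* `shiftCharZ_eq_shiftChar`: for `k = m + 1` it is `T5DVRQuotientModel.shiftChar`.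

Nothing about local fields or Haar measures is defined here.
-/

namespace Summit.Ventures.HodgeRepro2.T5ShiftCharacter

open Summit.Ventures.HodgeRepro2.T5DVRQuotientModel

variable {𝒪 : Type*} [CommRing 𝒪] [IsDomain 𝒪] [IsDiscreteValuationRing 𝒪] {ϖ : 𝒪} {m : ℕ}
  {K : Type*} [Field K] [Algebra 𝒪 K] [IsFractionRing 𝒪 K] {M : Type*} [CommMonoid M]

/-- The quotient map `𝒪 → 𝒪 ⧸ (ϖ^{m+1})`. -/
local notation "π" => Ideal.Quotient.mk (Ideal.span ({ϖ ^ (m + 1)} : Set 𝒪))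

omit [IsDomain 𝒪] [IsDiscreteValuationRing 𝒪] [IsFractionRing 𝒪 K] in
/-- The additive character `x ↦ Ψ(x · ϖ^{-k})` of `𝒪`, `k ∈ ℤ`. -/
noncomputable def shiftCharAuxZ (Ψ : AddChar K M) (ϖ : 𝒪) (k : ℤ) : AddChar 𝒪 M :=
  Ψ.compAddMonoidHom
    ((AddMonoidHom.mulRight (algebraMap 𝒪 K ϖ ^ (-k))).comp (algebraMap 𝒪 K).toAddMonoidHom)

omit [IsDomain 𝒪] [IsDiscreteValuationRing 𝒪] [IsFractionRing 𝒪 K] in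
/-- `shiftCharAuxZ Ψ ϖ k x = Ψ (x · ϖ^{-k})`. -/
@[simp] theorem shiftCharAuxZ_apply (Ψ : AddChar K M) (ϖ : 𝒪) (k : ℤ) (x : 𝒪) :
    shiftCharAuxZ Ψ ϖ k x = Ψ (algebraMap 𝒪 K x * algebraMap 𝒪 K ϖ ^ (-k)) := rfl

omit [IsDomain 𝒪] [IsDiscreteValuationRing 𝒪] in
/-- If `Ψ` is trivial on `ϖ^{m+1-k}𝒪`, then `x ↦ Ψ(x ϖ^{-k})` is trivial on the ideal `(ϖ^{m+1})`. -/
theorem shiftCharAuxZ_eq_one_of_mem (hϖ : Irreducible ϖ) (Ψ : AddChar K M) (k : ℤ)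
    (hΨ : ∀ x : 𝒪, Ψ (algebraMap 𝒪 K x * algebraMap 𝒪 K ϖ ^ ((m + 1 : ℕ) - k)) = 1) {x : 𝒪}
    (hx : x ∈ Ideal.span ({ϖ ^ (m + 1)} : Set 𝒪)) : shiftCharAuxZ Ψ ϖ k x = 1 := by
  obtain ⟨y, rfl⟩ := Ideal.mem_span_singleton.1 hx
  have hϖK : algebraMap 𝒪 K ϖ ≠ 0 := by
    rw [Ne, IsFractionRing.to_map_eq_zero_iff]
    exact hϖ.ne_zero
  rw [shiftCharAuxZ_apply, map_mul (algebraMap 𝒪 K), map_pow (algebraMap 𝒪 K), ← hΨ y]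
  congr 1
  rw [← zpow_natCast, mul_right_comm, ← zpow_add₀ hϖK, mul_comm, sub_eq_add_neg]

variable (m) in
/-- **Kudla's `ψ_n` at arbitrary conductor.** For an additive character `Ψ` of the fraction field trivial
on `ϖ^{m+1-k}𝒪`, the additive character `π x ↦ Ψ(x ϖ^{-k})` of `𝒪 ⧸ (ϖ^{m+1})`. -/
noncomputable def shiftCharZ (hϖ : Irreducible ϖ) (Ψ : AddChar K M) (k : ℤ)
    (hΨ : ∀ x : 𝒪, Ψ (algebraMap 𝒪 K x * algebraMap 𝒪 K ϖ ^ ((m + 1 : ℕ) - k)) = 1) :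
    AddChar (𝒪 ⧸ Ideal.span ({ϖ ^ (m + 1)} : Set 𝒪)) M :=
  descend _ (shiftCharAuxZ Ψ ϖ k) (fun _ hx => shiftCharAuxZ_eq_one_of_mem hϖ Ψ k hΨ hx)

omit [IsDomain 𝒪] [IsDiscreteValuationRing 𝒪] in
/-- `shiftCharZ m hϖ Ψ k hΨ (π x) = Ψ (x · ϖ^{-k})`. -/
@[simp] theorem shiftCharZ_mk (hϖ : Irreducible ϖ) (Ψ : AddChar K M) (k : ℤ)
    (hΨ : ∀ x : 𝒪, Ψ (algebraMap 𝒪 K x * algebraMap 𝒪 K ϖ ^ ((m + 1 : ℕ) - k)) = 1) (x : 𝒪) :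
    shiftCharZ m hϖ Ψ k hΨ (π x) = Ψ (algebraMap 𝒪 K x * algebraMap 𝒪 K ϖ ^ (-k)) := rfl

/-- **Primitivity at arbitrary conductor.** `π x ↦ Ψ(x ϖ^{-k})` is primitive on `𝒪 ⧸ (ϖ^{m+1})` iff `Ψ` is
non-trivial on `ϖ^{m-k}𝒪`: together with `hΨ` (triviality on `ϖ^{m+1-k}𝒪`), «the conductor of `Ψ` is exactly
`ϖ^{m+1-k}𝒪`», i.e. `k = ν + (m + 1)` for `Ψ` of conductor `𝔭^{-ν}` — Kudla's shift `ϖ^{-ν-c}`, `c = m + 1`. -/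
theorem isPrimitive_shiftCharZ_iff (hϖ : Irreducible ϖ) (Ψ : AddChar K M) (k : ℤ)
    (hΨ : ∀ x : 𝒪, Ψ (algebraMap 𝒪 K x * algebraMap 𝒪 K ϖ ^ ((m + 1 : ℕ) - k)) = 1) :
    (shiftCharZ m hϖ Ψ k hΨ).IsPrimitive
      ↔ ∃ y : 𝒪, Ψ (algebraMap 𝒪 K y * algebraMap 𝒪 K ϖ ^ ((m : ℕ) - k)) ≠ 1 := by
  have hϖK : algebraMap 𝒪 K ϖ ≠ 0 := by
    rw [Ne, IsFractionRing.to_map_eq_zero_iff]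
    exact hϖ.ne_zero
  rw [isPrimitive_iff_socle hϖ]
  refine exists_congr (fun r => ?_)
  rw [shiftCharZ_mk, map_mul (algebraMap 𝒪 K), map_pow (algebraMap 𝒪 K), ← zpow_natCast, mul_assoc,
    ← zpow_add₀ hϖK, sub_eq_add_neg]

omit [IsDomain 𝒪] [IsDiscreteValuationRing 𝒪] in
/-- For `k = m + 1` (`Ψ` trivial on `𝒪`) this is `T5DVRQuotientModel.shiftChar`. -/
theorem shiftCharZ_eq_shiftChar (hϖ : Irreducible ϖ) (Ψ : AddChar K M)
    (hΨ : ∀ x : 𝒪, Ψ (algebraMap 𝒪 K x) = 1) :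
    shiftCharZ m hϖ Ψ (m + 1 : ℕ) (fun x => by simpa using hΨ x) = shiftChar m hϖ Ψ hΨ := by
  ext q
  obtain ⟨x, rfl⟩ := Ideal.Quotient.mk_surjective q
  rw [shiftCharZ_mk, shiftChar_mk, zpow_neg, zpow_natCast, div_eq_mul_inv]

end Summit.Ventures.HodgeRepro2.T5ShiftCharacter
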